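import Summits.HubbardSuperconductivity.HubbardSuperconductivity.Theorems.AnisotropyChordTransferFibre3FinXDSums

/-!
# Route `AnisotropyChord` / H0 rotor rung: FIN per-`L` row-D evaluator XD — soundness layer 1c: the cell tables enclose `T`, `G₃`, `W`

The real-side objects of the XD tables at integer momenta — `Tq` (`Σ_p g(p)g(p+q)`), `G3q` (`Σ_p g(p)g(p+q₂)g(p−q₃)`), `Wq`
(`Σ_p e^{ip·x̂} g(p)g(q−p)`, complex) — their natural-coordinate forms (`natT_eq`, `natG3_eq`, `natW_eq`), ★ `Wq_lipschitz`
(`|W(q;λ) − W(q;λ₀)| ≤ T(q;λ) − T(q;λ₀)` componentwise for `λ₀ ≤ λ < 2ε₁`: termwise `g g′ ≥ g₀ g₀′ ≥ 0`), the hypothesis bundle `XDHyp`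
of a ground profile in a checked cell, and ★ `XDHyp.mem_T / mem_G3 / mem_Wx`: the cell tables of `xdCell L la lb (xdPoint L la) (xdPoint L lb)`
enclose `T(q;λ₂)`, `G₃(q₂,q₃;λ₂)`, `W(q;λ₂)` at the keys, for EVERY ground profile whose `λ₂` lies in the cell.
Prover seat `hubbard-h0-rotor-p3` g7; helper for piece A = stmt-HubbardSuperconductivity-23918 of rung 19089 (`--supports`, helper class).
WHAT THIS IS NOT: nothing here proves superconductivity in the Hubbard model (rotor TARGET as worded stays FALSE, g15 verdict); evaluator
soundness for the FIN certificates of ONE conditional reduction.  Tree imports only; no sorry, no new axioms.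
-/

set_option linter.dupNamespace false
set_option autoImplicit false

namespace Summit.HubbardSuperconductivity.HubbardSuperconductivity.Theorems.AnisotropyChord.Transfer.Fibre3

namespace FinXD

open scoped BigOperators
open Finset Hole2 FinCell FinXB

/-! ## The real-side objects at integer momenta -/

section real

variable {L : ℕ} [NeZero L]

/-- `T(q;λ) := Σ_p g(p) g(p + q)`. -/
noncomputable def Tq (L : ℕ) [NeZero L] (lam : ℝ) (q : ℤ × ℤ) : ℝ :=
  ∑ p : Tor L, gres L lam p * gres L lam (p + B1.toTor L q)

/-- `G₃(q₂,q₃;λ) := Σ_p g(p) g(p + q₂) g(p − q₃)`. -/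
noncomputable def G3q (L : ℕ) [NeZero L] (lam : ℝ) (K : (ℤ × ℤ) × (ℤ × ℤ)) : ℝ :=
  ∑ p : Tor L, gres L lam p * gres L lam (p + B1.toTor L K.1) * gres L lam (p - B1.toTor L K.2)

/-- `W(q;λ) := Σ_p e^{ip·x̂} g(p) g(q − p)` (complex). -/
noncomputable def Wq (L : ℕ) [NeZero L] (lam : ℝ) (q : ℤ × ℤ) : ℂ :=
  ∑ p : Tor L, phase L p (K1 L) * ((gres L lam p * gres L lam (B1.toTor L q - p) : ℝ) : ℂ)

/-- casts: a reduced natural sum of coordinates is the `ZMod` sum. [folklore] -/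
theorem cast_add_mod (i : ℕ) (z : ℤ) : ((((i + modNat L z) % L : ℕ)) : ZMod L) = (i : ZMod L) + ((z : ℤ) : ZMod L) := by
  have hL : 0 < L := Nat.pos_of_ne_zero (NeZero.ne L)
  rw [ZMod.natCast_mod, Nat.cast_add, modNat_cast L hL]

/-- casts: `(q + L − p) % L` is `q − p` in `ZMod L` (`p < L`). [folklore] -/
theorem cast_sub_mod {p : ℕ} (hp : p < L) (z : ℤ) :
    ((((modNat L z + L - p) % L : ℕ)) : ZMod L) = ((z : ℤ) : ZMod L) - (p : ZMod L) := by
  have hL : 0 < L := Nat.pos_of_ne_zero (NeZero.ne L)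
  rw [ZMod.natCast_mod, Nat.cast_sub (by omega), Nat.cast_add, modNat_cast L hL, ZMod.natCast_self]
  ring

/-- ★ the natural double sum is `T(q)`. [folklore] -/
theorem natT_eq (lam : ℝ) (q : ℤ × ℤ) : natT L lam (modNat L q.1) (modNat L q.2) = Tq L lam q := by
  unfold natT Tq
  rw [sum_tor_range]
  refine Finset.sum_congr rfl fun i _ => Finset.sum_congr rfl fun j _ => ?_
  have e : ((((i : ℕ) : ZMod L), ((j : ℕ) : ZMod L)) : Tor L) + B1.toTor L q
      = (((((i + modNat L q.1) % L : ℕ)) : ZMod L), ((((j + modNat L q.2) % L : ℕ)) : ZMod L)) := by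
    unfold B1.toTor
    refine Prod.ext ?_ ?_
    · simp only [Prod.fst_add, cast_add_mod]
    · simp only [Prod.snd_add, cast_add_mod]
  unfold xg
  rw [e]

/-- ★ the natural double sum is `G₃(q₂,q₃)`. [folklore] -/
theorem natG3_eq (lam : ℝ) (K : (ℤ × ℤ) × (ℤ × ℤ)) :
    natG3 L lam (modNat L K.1.1) (modNat L K.1.2) (modNat L (-K.2.1)) (modNat L (-K.2.2)) = G3q L lam K := by
  unfold natG3 G3q
  rw [sum_tor_range]
  refine Finset.sum_congr rfl fun i _ => Finset.sum_congr rfl fun j _ => ?_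
  have e1 : ((((i : ℕ) : ZMod L), ((j : ℕ) : ZMod L)) : Tor L) + B1.toTor L K.1
      = (((((i + modNat L K.1.1) % L : ℕ)) : ZMod L), ((((j + modNat L K.1.2) % L : ℕ)) : ZMod L)) := by
    unfold B1.toTor
    refine Prod.ext ?_ ?_
    · simp only [Prod.fst_add, cast_add_mod]
    · simp only [Prod.snd_add, cast_add_mod]
  have e2 : ((((i : ℕ) : ZMod L), ((j : ℕ) : ZMod L)) : Tor L) - B1.toTor L K.2
      = (((((i + modNat L (-K.2.1)) % L : ℕ)) : ZMod L), ((((j + modNat L (-K.2.2)) % L : ℕ)) : ZMod L)) := by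
    unfold B1.toTor
    refine Prod.ext ?_ ?_
    · simp only [cast_add_mod, Int.cast_neg, sub_eq_add_neg, Prod.fst_add, Prod.fst_neg]
    · simp only [cast_add_mod, Int.cast_neg, sub_eq_add_neg, Prod.snd_add, Prod.snd_neg]
  unfold xg
  rw [e1, e2]

/-- the weight `Re e^{ip·x̂} = cos(2πp₁/L)`, `Im = sin` at a natural momentum. [folklore] -/
theorem phase_K1_nat (hL : 3 ≤ L) {p1 p2 : ℕ} (hp1 : p1 < L) (hp2 : p2 < L) :
    (phase L ((((p1 : ℕ) : ZMod L), ((p2 : ℕ) : ZMod L))) (K1 L)).re = Real.cos (2 * Real.pi * p1 / L) ∧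
    (phase L ((((p1 : ℕ) : ZMod L), ((p2 : ℕ) : ZMod L))) (K1 L)).im = Real.sin (2 * Real.pi * p1 / L) := by
  have h := phase_dir L hL (show 0 < 4 by norm_num) hp1 hp2
  have e0 : eDir L 0 = K1 L := by unfold eDir; rw [if_pos rfl, K1_eq_ex]
  have hidx : phIdx L 0 p1 p2 = p1 := by unfold phIdx; rw [if_pos rfl, Nat.mod_eq_of_lt hp1]
  rw [e0, hidx] at h
  exact h

/-- ★ the natural sums are the real and imaginary parts of `W(q)`. [folklore] -/
theorem natW_eq (hL : 3 ≤ L) (lam : ℝ) (q : ℤ × ℤ) :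
    (Wq L lam q).re = natWre L lam (modNat L q.1) (modNat L q.2) ∧
    (Wq L lam q).im = natWim L lam (modNat L q.1) (modNat L q.2) := by
  have hL0 : 0 < L := by omega
  have key : ∀ i j : ℕ, i < L → j < L →
      gres L lam (B1.toTor L q - ((((i : ℕ) : ZMod L), ((j : ℕ) : ZMod L)) : Tor L))
        = xg (L := L) lam ((modNat L q.1 + L - i) % L) ((modNat L q.2 + L - j) % L) := by
    intro i j hi hj
    unfold xg
    congr 1
    unfold B1.toTor
    ext <;> simp [cast_sub_mod hi, cast_sub_mod hj]
  unfold Wq natWre natWim rowR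
  rw [Complex.re_sum, Complex.im_sum, sum_tor_range, sum_tor_range]
  constructor
  · refine Finset.sum_congr rfl fun i hi => ?_
    rw [mem_range] at hi
    rw [Finset.mul_sum]
    refine Finset.sum_congr rfl fun j hj => ?_
    rw [mem_range] at hj
    rw [Complex.re_mul_ofReal, (phase_K1_nat hL hi hj).1, key i j hi hj]
    unfold xg
    ring
  · refine Finset.sum_congr rfl fun i hi => ?_
    rw [mem_range] at hi
    rw [Finset.mul_sum]
    refine Finset.sum_congr rfl fun j hj => ?_
    rw [mem_range] at hj
    rw [Complex.im_mul_ofReal, (phase_K1_nat hL hi hj).2, key i j hi hj]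
    unfold xg
    ring

/-- `g` is nonnegative and increasing in `λ` below `2ε₁`. [folklore] -/
theorem gres_mono_lam (hL : 2 ≤ L) {lam0 lam : ℝ} (h0 : lam0 ≤ lam) (h1 : lam < 2 * eps1 L) (p : Tor L) :
    0 ≤ gres L lam0 p ∧ gres L lam0 p ≤ gres L lam p := by
  unfold gres
  by_cases hp : p = 0
  · simp [hp]
  · rw [if_neg hp, if_neg hp]
    have he := eps1_le_epsT L hL hp
    have d1 : 0 < 2 * epsT L p - lam := by linarith
    have d0 : 0 < 2 * epsT L p - lam0 := by linarith
    exact ⟨(one_div_pos.mpr d0).le, one_div_le_one_div_of_le d1 (by linarith)⟩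

/-- `Σ_p g(p) g(q − p) = T(q)` (evenness of `g` and a translation). [folklore] -/
theorem sum_gg_refl (lam : ℝ) (q : ℤ × ℤ) :
    (∑ p : Tor L, gres L lam p * gres L lam (B1.toTor L q - p)) = Tq L lam q := by
  unfold Tq
  set t := B1.toTor L q
  have h1 : (∑ p : Tor L, gres L lam p * gres L lam (t - p)) = ∑ p : Tor L, gres L lam p * gres L lam (p - t) := by
    refine Finset.sum_congr rfl fun p _ => ?_
    rw [← B1.gres_neg L lam (t - p), neg_sub]
  rw [h1, show (∑ p : Tor L, gres L lam p * gres L lam (p + t)) = ∑ p : Tor L, gres L lam (p + t) * gres L lam p from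
    Finset.sum_congr rfl (fun p _ => mul_comm _ _)]
  exact Fintype.sum_equiv (Equiv.subRight t) _ _ (fun p => by simp)

/-- ★ LIPSCHITZ IN `λ`: `|W(q;λ) − W(q;λ₀)| ≤ T(q;λ) − T(q;λ₀)` componentwise (`λ₀ ≤ λ < 2ε₁`). [folklore] -/
theorem Wq_lipschitz (hL : 2 ≤ L) {lam0 lam : ℝ} (h0 : lam0 ≤ lam) (h1 : lam < 2 * eps1 L) (q : ℤ × ℤ) :
    |(Wq L lam q).re - (Wq L lam0 q).re| ≤ Tq L lam q - Tq L lam0 q ∧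
    |(Wq L lam q).im - (Wq L lam0 q).im| ≤ Tq L lam q - Tq L lam0 q := by
  rw [← sum_gg_refl lam q, ← sum_gg_refl lam0 q]
  set t := B1.toTor L q
  -- termwise: `0 ≤ g₀ g₀' ≤ g g'`
  have hterm : ∀ p : Tor L, 0 ≤ gres L lam0 p * gres L lam0 (t - p) ∧
      gres L lam0 p * gres L lam0 (t - p) ≤ gres L lam p * gres L lam (t - p) := by
    intro p
    obtain ⟨a0, a1⟩ := gres_mono_lam hL h0 h1 p
    obtain ⟨b0, b1⟩ := gres_mono_lam hL h0 h1 (t - p)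
    exact ⟨mul_nonneg a0 b0, mul_le_mul a1 b1 b0 (a0.trans a1)⟩
  have hdiff : ∀ F : Tor L → ℝ, (∀ p, |F p| ≤ 1) →
      |(∑ p : Tor L, F p * (gres L lam p * gres L lam (t - p))) - ∑ p : Tor L, F p * (gres L lam0 p * gres L lam0 (t - p))|
        ≤ (∑ p : Tor L, gres L lam p * gres L lam (t - p)) - ∑ p : Tor L, gres L lam0 p * gres L lam0 (t - p) := by
    intro F hF
    rw [← Finset.sum_sub_distrib, ← Finset.sum_sub_distrib]
    refine (Finset.abs_sum_le_sum_abs _ _).trans (Finset.sum_le_sum fun p _ => ?_)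
    rw [← mul_sub, abs_mul]
    have hnn : 0 ≤ gres L lam p * gres L lam (t - p) - gres L lam0 p * gres L lam0 (t - p) := by
      linarith [(hterm p).2]
    rw [abs_of_nonneg hnn]
    calc |F p| * (gres L lam p * gres L lam (t - p) - gres L lam0 p * gres L lam0 (t - p))
        ≤ 1 * (gres L lam p * gres L lam (t - p) - gres L lam0 p * gres L lam0 (t - p)) :=
          mul_le_mul_of_nonneg_right (hF p) hnn
      _ = _ := one_mul _
  have hre : ∀ μ : ℝ, (Wq L μ q).re = ∑ p : Tor L, (phase L p (K1 L)).re * (gres L μ p * gres L μ (t - p)) := by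
    intro μ; unfold Wq; rw [Complex.re_sum]
    exact Finset.sum_congr rfl fun p _ => by rw [Complex.re_mul_ofReal]
  have him : ∀ μ : ℝ, (Wq L μ q).im = ∑ p : Tor L, (phase L p (K1 L)).im * (gres L μ p * gres L μ (t - p)) := by
    intro μ; unfold Wq; rw [Complex.im_sum]
    exact Finset.sum_congr rfl fun p _ => by rw [Complex.im_mul_ofReal]
  have hn : ∀ p : Tor L, |(phase L p (K1 L)).re| ≤ 1 ∧ |(phase L p (K1 L)).im| ≤ 1 := by
    intro p
    have h := norm_phase L p (K1 L)
    exact ⟨(Complex.abs_re_le_norm _).trans h.le, (Complex.abs_im_le_norm _).trans h.le⟩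
  rw [hre lam, hre lam0, him lam, him lam0]
  exact ⟨hdiff _ (fun p => (hn p).1), hdiff _ (fun p => (hn p).2)⟩

end real

/-! ## The cell tables of `xdCell` enclose `T`, `G₃`, `W` for every ground profile of the cell -/

section tables

variable {L : ℕ} [NeZero L]

/-- common hypotheses of the XD cell lemmas, bundled. -/
structure XDHyp (Δ lam2 : ℝ) (f : Tor L → ℝ) (la lb : ℤ) : Prop where
  /-- `9 ≤ L` -/
  hL : 9 ≤ L
  /-- `0 ≤ Δ` -/
  hΔ0 : 0 ≤ Δ
  /-- `Δ < 1` -/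
  hΔ1 : Δ < 1
  /-- the ground profile -/
  hf : IsGroundTwoMagnon L Δ lam2 f
  /-- cell lower end -/
  hla : (la : ℝ) ≤ lam2 * ((D : ℤ) : ℝ)
  /-- cell upper end -/
  hlb : lam2 * ((D : ℤ) : ℝ) ≤ (lb : ℝ)
  /-- g4's ground-cell check -/
  hchk : groundCellCheck L la lb = true
  /-- `1 − Δ > 0` on the cell -/
  hsc : xbScalOK L la lb = true
  /-- positive denominators at the point `la` -/
  hpos0 : denCellPos L (cosTab L) la la = true
  /-- nonnegative lower point table at `la` -/
  hna : gPtNonneg L la = true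

namespace XDHyp

variable {Δ lam2 : ℝ} {f : Tor L → ℝ} {la lb : ℤ} (H : XDHyp (L := L) Δ lam2 f la lb)
include H

/-- the XB cell hypotheses. [folklore] -/
theorem cellHyp : CellHyp (L := L) Δ lam2 f la lb := ⟨by have := H.hL; omega, H.hΔ0, H.hΔ1, H.hf, H.hla, H.hlb, H.hchk, H.hsc⟩
/-- `λ₂ < 2ε₁`. [folklore] -/
theorem hlt : lam2 < 2 * eps1 L := lam2_lt_two_eps1 L (by have := H.hL; omega) H.hΔ0 H.hf
/-- the point `λ₀ = la/D` lies in the cell. [folklore] -/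
theorem lam0_mem : ((la : ℝ) ≤ (la : ℝ) / ((D : ℤ) : ℝ) * ((D : ℤ) : ℝ)) ∧ ((la : ℝ) / ((D : ℤ) : ℝ) * ((D : ℤ) : ℝ) ≤ (lb : ℝ))
    ∧ ((la : ℝ) / ((D : ℤ) : ℝ) * ((D : ℤ) : ℝ) ≤ (la : ℝ)) ∧ (la : ℝ) / ((D : ℤ) : ℝ) ≤ lam2 := by
  have hD := D_pos
  have e : (la : ℝ) / ((D : ℤ) : ℝ) * ((D : ℤ) : ℝ) = la := div_mul_cancel₀ _ (ne_of_gt hD)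
  rw [e]
  refine ⟨le_rfl, ?_, le_rfl, ?_⟩
  · exact_mod_cast (show (la : ℝ) ≤ (lb : ℝ) from H.hla.trans H.hlb)
  · rw [div_le_iff₀ hD]; exact H.hla

/-- ★ `T(q) ∈ C.T q` for the keys. [folklore] -/
theorem mem_T {q : ℤ × ℤ} (hq : q ∈ keysQ) :
    mem (Tq L lam2 q) ((xdCell L la lb (xdPoint L la) (xdPoint L lb)).T q) := by
  have hi := fidx_lt hq
  unfold XDCell.T xdCell
  simp only
  rw [getIv_map_range _ hi]
  unfold xdPoint xdPointOf
  simp only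
  rw [getIv_map_fidx hq, getIv_map_fidx hq, ← natT_eq]
  exact ⟨roundP_fst_le (sumT_lower H.cellHyp.hL3 H.hla H.hlb H.cellHyp.hpos H.hna _ _),
    le_roundP_snd (sumT_upper H.cellHyp.hL3 H.hla H.hlb H.cellHyp.hpos H.hna _ _)⟩

/-- the lower end of `C.T q` is below `D·T(q;λ₀)` at the point `λ₀ = la/D` too. [folklore] -/
theorem T_fst_le_lam0 {q : ℤ × ℤ} (hq : q ∈ keysQ) :
    ((((xdCell L la lb (xdPoint L la) (xdPoint L lb)).T q).1 : ℤ) : ℝ) ≤ Tq L ((la : ℝ) / ((D : ℤ) : ℝ)) q * ((D : ℤ) : ℝ) := by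
  have hi := fidx_lt hq
  obtain ⟨h0a, h0b, -, -⟩ := H.lam0_mem
  unfold XDCell.T xdCell
  simp only
  rw [getIv_map_range _ hi]
  unfold xdPoint xdPointOf
  simp only
  rw [getIv_map_fidx hq, ← natT_eq]
  exact roundP_fst_le (sumT_lower H.cellHyp.hL3 h0a h0b H.cellHyp.hpos H.hna _ _)

/-- ★ `G₃(q₂,q₃) ∈ C.G3 K` for the keys. [folklore] -/
theorem mem_G3 {K : (ℤ × ℤ) × (ℤ × ℤ)} (hK : K ∈ keys3) :
    mem (G3q L lam2 K) ((xdCell L la lb (xdPoint L la) (xdPoint L lb)).G3 K) := by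
  have hi := fidx_lt hK
  unfold XDCell.G3 xdCell
  simp only
  rw [getIv_map_range _ hi]
  unfold xdPoint xdPointOf
  simp only
  rw [getIv_map_fidx hK, getIv_map_fidx hK, ← natG3_eq]
  exact ⟨round3_fst_le (sumG3_lower H.cellHyp.hL3 H.hla H.hlb H.cellHyp.hpos H.hna _ _ _ _),
    le_round3_snd (sumG3_upper H.cellHyp.hL3 H.hla H.hlb H.cellHyp.hpos H.hna _ _ _ _)⟩

/-- `W(q;λ₀)` at the point is enclosed by the point table entry. [folklore] -/
theorem mem_W_lam0 {q : ℤ × ℤ} (hq : q ∈ keysQ) :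
    mem (Wq L ((la : ℝ) / ((D : ℤ) : ℝ)) q).re ((xdPoint L la).tW.getD (fidx keysQ q) czero).1 ∧
    mem (Wq L ((la : ℝ) / ((D : ℤ) : ℝ)) q).im ((xdPoint L la).tW.getD (fidx keysQ q) czero).2 := by
  have hL0 : 0 < L := by have := H.hL; omega
  obtain ⟨h0a, -, h0c, -⟩ := H.lam0_mem
  unfold xdPoint xdPointOf
  simp only
  rw [getD_map_fidx hq]
  simp only
  have hw := sumW_mem H.cellHyp.hL3 h0a h0c H.hpos0 H.hna (q1 := modNat L q.1) (modNat_lt L hL0 q.2) L le_rfl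
  obtain ⟨w1, w2, w3, w4⟩ := hw
  have hre := (natW_eq H.cellHyp.hL3 ((la : ℝ) / ((D : ℤ) : ℝ)) q).1
  have him := (natW_eq H.cellHyp.hL3 ((la : ℝ) / ((D : ℤ) : ℝ)) q).2
  unfold natWre at hre
  unfold natWim at him
  unfold sumW
  constructor
  · rw [hre]
    exact ⟨round3_fst_le (by simpa [mul_assoc] using w1), le_round3_snd (by simpa [mul_assoc] using w2)⟩
  · rw [him]
    exact ⟨round3_fst_le (by simpa [mul_assoc] using w3), le_round3_snd (by simpa [mul_assoc] using w4)⟩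

/-- ★ `W(q;λ₂) ∈ C.Wx q` for the keys (point value widened by the variation of `T`). [folklore] -/
theorem mem_Wx {q : ℤ × ℤ} (hq : q ∈ keysQ) :
    mem (Wq L lam2 q).re ((xdCell L la lb (xdPoint L la) (xdPoint L lb)).Wx q).1 ∧
    mem (Wq L lam2 q).im ((xdCell L la lb (xdPoint L la) (xdPoint L lb)).Wx q).2 := by
  have hi := fidx_lt hq
  have hD := D_pos
  obtain ⟨-, -, -, h0le⟩ := H.lam0_mem
  have hlip := Wq_lipschitz (L := L) (by have := H.hL; omega) h0le H.hlt q
  have hT := H.mem_T hq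
  have hT0 := H.T_fst_le_lam0 hq
  have hW0 := H.mem_W_lam0 hq
  -- unfold the cell entry
  have e : (xdCell L la lb (xdPoint L la) (xdPoint L lb)).Wx q
      = cwiden ((xdPoint L la).tW.getD (fidx keysQ q) ((0, 0), (0, 0)))
          ((((xdCell L la lb (xdPoint L la) (xdPoint L lb)).T q).2) - (((xdCell L la lb (xdPoint L la) (xdPoint L lb)).T q).1)) := by
    unfold XDCell.Wx XDCell.T xdCell
    simp only
    rw [List.getD_eq_getElem _ _ (by simpa using hi), List.getElem_map, List.getElem_range, getIv_map_range _ hi]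
  rw [e]
  unfold cwiden czero at *
  obtain ⟨⟨r1, r2⟩, ⟨i1, i2⟩⟩ := hW0
  obtain ⟨t1, t2⟩ := hT
  have hvar : (Tq L lam2 q - Tq L ((la : ℝ) / ((D : ℤ) : ℝ)) q) * ((D : ℤ) : ℝ)
      ≤ ((((xdCell L la lb (xdPoint L la) (xdPoint L lb)).T q).2 : ℤ) : ℝ)
        - ((((xdCell L la lb (xdPoint L la) (xdPoint L lb)).T q).1 : ℤ) : ℝ) := by
    nlinarith
  obtain ⟨lre, lim⟩ := hlip
  rw [abs_le] at lre lim
  unfold mem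
  simp only
  push_cast
  refine ⟨⟨by nlinarith, by nlinarith⟩, ⟨by nlinarith, by nlinarith⟩⟩

end XDHyp

end tables

end FinXD

end Summit.HubbardSuperconductivity.HubbardSuperconductivity.Theorems.AnisotropyChord.Transfer.Fibre3
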